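import Literature.Computability.Complexity.HiraharaSpec
import HarnessLib

/-!
# Hirahara's reduction: the coin budget is polynomial

Topic `Computability/Complexity`. The number of coins `totCoins = Σ_k 2^{N_k}` read by Hirahara's
reduction (`HiraharaSpec.lean`: `HiraharaRed.PInst.totCoins`, `coinsOf`; one uniformly random
truth table `f_k ∼ {0,1}^{λ w(k)}` per variable, ECCC TR22-119, proof of Lemma 8.3) on the
preprocessed instance `Pre.toPInst I₀` (`HiraharaPreprocess.lean`: `λ = 2^{Λ}`,
`Λ = 4(⌊log₂ L'⌋ + 1) + 4096`, `L' = n + m + W`) is bounded by an explicit polynomial in the code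
length of the CMMSA instance: `totCoins ≤ 2^{4096} · 32 · max(1, L')^5 ≤ 2^{4096} · 1024 · (|code I₀| + 1)^5`
(`2^{N_k} ≤ 2 λ max(1, w_k)`, `λ ≤ 2^{4096} (2 max(1, L'))^4`, `Σ_k max(1, w_k) ≤ n + W ≤ L'`,
`L' ≤ 2 |code I₀|`). This is the coin-budget hypothesis of the assembly theorems of
`MCSPStarFromRedOut.lean` (`…_of_pairFn`), discharged once and for all
(`HiraharaRed.totCoins_toPInst_le_eval`, with the polynomial `HiraharaRed.coinPoly`).

## References

* S. Hirahara, *NP-hardness of learning programs and partial MCSP*, ECCC TR22-119, proof of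
  Lemma 8.3 ("Parameters and the distribution": `λ := poly(…)`, `fᵢ ∼ {0,1}^{λ w(i)}`) and of
  Thm. 8.5 (the reduction is randomized polynomial time) [Hirahara2022PartialMCSP].
-/

namespace Literature.Computability.Complexity

open Finset
open Literature.Computability.MetaComplexity (CMMSAInstance)

namespace HiraharaRed

variable (I₀ : CMMSAInstance)

/-- `λ ≤ 2^{4096} · (2 max(1, L'))^4` for the preprocessed instance. [cite: Hirahara2022PartialMCSP, proof of Lemma 8.3 (λ := poly(n, m, w_max))] -/
theorem lam_toPInst_le : (Pre.toPInst I₀).lam ≤ 2 ^ 4096 * (2 * max 1 (Pre.sizeOf I₀)) ^ 4 := by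
  have hlam : (Pre.toPInst I₀).lam = 2 ^ (4 * (Nat.log 2 (Pre.sizeOf I₀) + 1) + 4096) := rfl
  have h2 : 2 ^ (Nat.log 2 (Pre.sizeOf I₀) + 1) ≤ 2 * max 1 (Pre.sizeOf I₀) := by
    rcases Nat.eq_zero_or_pos (Pre.sizeOf I₀) with h0 | hpos
    · rw [h0]; simp
    · rw [pow_succ, mul_comm]
      exact Nat.mul_le_mul_left 2 ((Nat.pow_log_le_self 2 hpos.ne').trans (le_max_right _ _))
  rw [hlam, pow_add, pow_mul', mul_comm]
  exact Nat.mul_le_mul_left _ (Nat.pow_le_pow_left h2 4)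

/-- `Σ_k max(1, w_k) ≤ n + W ≤ L'`. [folklore] -/
theorem sum_max_one_w_le : ∑ k : Fin I₀.numVars, max 1 (I₀.w k) ≤ Pre.sizeOf I₀ := by
  calc ∑ k : Fin I₀.numVars, max 1 (I₀.w k) ≤ ∑ k : Fin I₀.numVars, (1 + I₀.w k) :=
        sum_le_sum fun k _ => max_le (Nat.le_add_right _ _) (Nat.le_add_left _ _)
    _ = I₀.numVars + ∑ k : Fin I₀.numVars, I₀.w k := by
        rw [sum_add_distrib]; simp
    _ = I₀.numVars + Pre.totalW I₀ := by
        unfold Pre.totalW; rw [Fin.sum_univ_eq_sum_range]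
    _ ≤ Pre.sizeOf I₀ := by unfold Pre.sizeOf; omega

/-- **The coin budget is polynomial in the size measure**: `totCoins ≤ 2^{4096} · 32 · max(1, L')^5`.
[cite: Hirahara2022PartialMCSP, proof of Lemma 8.3 and of Thm. 8.5 (randomized polynomial time)] -/
theorem totCoins_toPInst_le :
    (Pre.toPInst I₀).totCoins ≤ 2 ^ 4096 * (32 * max 1 (Pre.sizeOf I₀) ^ 5) := by
  set M := max 1 (Pre.sizeOf I₀) with hM
  have hN : ∀ k : Fin I₀.numVars, 2 ^ (Pre.toPInst I₀).N k ≤ 2 * (max 1 (I₀.w k) * (Pre.toPInst I₀).lam) :=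
    fun k => (Pre.toPInst I₀).two_pow_N_le k
  have hsum : ∑ k : Fin I₀.numVars, max 1 (I₀.w k) ≤ M := (sum_max_one_w_le I₀).trans (le_max_right _ _)
  have hlam : (Pre.toPInst I₀).lam ≤ 2 ^ 4096 * (2 * M) ^ 4 := lam_toPInst_le I₀
  generalize hA : (2 : ℕ) ^ 4096 = A at hlam ⊢
  calc (Pre.toPInst I₀).totCoins = ∑ k : Fin I₀.numVars, 2 ^ (Pre.toPInst I₀).N k := rfl
    _ ≤ ∑ k : Fin I₀.numVars, 2 * (max 1 (I₀.w k) * (Pre.toPInst I₀).lam) := sum_le_sum fun k _ => hN k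
    _ = 2 * (Pre.toPInst I₀).lam * ∑ k : Fin I₀.numVars, max 1 (I₀.w k) := by
        rw [mul_sum]; exact sum_congr rfl fun k _ => by ring
    _ ≤ 2 * (A * (2 * M) ^ 4) * M := by gcongr
    _ = A * (32 * M ^ 5) := by ring

/-- **The coin budget is polynomial in the code length**: for instances whose weight list has
length `n` (well-formed instances), `totCoins ≤ 2^{4096} · 1024 · (|code I₀| + 1)^5`. [cite: Hirahara2022PartialMCSP, proof of Thm. 8.5 (randomized polynomial-time reduction)] -/
theorem totCoins_toPInst_le_codeLen (hwf : I₀.weight.length = I₀.numVars) :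
    (Pre.toPInst I₀).totCoins ≤ 2 ^ 4096 * (1024 * (Pre.codeLen I₀ + 1) ^ 5) := by
  have hM : max 1 (Pre.sizeOf I₀) ≤ 2 * (Pre.codeLen I₀ + 1) :=
    max_le (by omega) ((Pre.sizeOf_le (I₀ := I₀) hwf).trans (by omega))
  have h := totCoins_toPInst_le I₀
  generalize hA : (2 : ℕ) ^ 4096 = A at h ⊢
  calc (Pre.toPInst I₀).totCoins ≤ A * (32 * max 1 (Pre.sizeOf I₀) ^ 5) := h
    _ ≤ A * (32 * (2 * (Pre.codeLen I₀ + 1)) ^ 5) := by gcongr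
    _ = A * (1024 * (Pre.codeLen I₀ + 1) ^ 5) := by ring

/-- The coin-budget polynomial `2^{4096} · 1024 · (X + 1)^5`. [folklore] -/
noncomputable def coinPoly : Polynomial ℕ :=
  Polynomial.C (2 ^ 4096 * 1024) * (Polynomial.X + 1) ^ 5

/-- Evaluation of the coin-budget polynomial. [folklore] -/
theorem coinPoly_eval (N : ℕ) : coinPoly.eval N = 2 ^ 4096 * 1024 * (N + 1) ^ 5 := by
  unfold coinPoly
  rw [Polynomial.eval_mul, Polynomial.eval_C, Polynomial.eval_pow, Polynomial.eval_add,
    Polynomial.eval_X, Polynomial.eval_one]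

/-- **The coin budget of well-formed instances is dominated by `coinPoly (|code I₀|)`.**
[cite: Hirahara2022PartialMCSP, proof of Thm. 8.5 (randomized polynomial-time reduction)] -/
theorem totCoins_toPInst_le_eval (hwf : I₀.WellFormed) :
    (Pre.toPInst I₀).totCoins ≤ coinPoly.eval (CMMSAInstance.encoding.encode I₀).length := by
  rw [coinPoly_eval, mul_assoc]
  exact totCoins_toPInst_le_codeLen I₀ hwf.1

/-- Hence some polynomial dominates the coin budget of every well-formed instance. [cite: Hirahara2022PartialMCSP, proof of Thm. 8.5 (randomized polynomial-time reduction)] -/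
theorem exists_poly_totCoins_le :
    ∃ q : Polynomial ℕ, ∀ I₀ : CMMSAInstance, I₀.WellFormed →
      (Pre.toPInst I₀).totCoins ≤ q.eval (CMMSAInstance.encoding.encode I₀).length :=
  ⟨coinPoly, fun I₀ h => totCoins_toPInst_le_eval I₀ h⟩

end HiraharaRed

end Literature.Computability.Complexity
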